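import Literature.NumberTheory.LFunctions.VinogradovZetaSumShift
import Literature.NumberTheory.LFunctions.GaussianPrimesInSectors
import Mathlib.Analysis.SpecialFunctions.Complex.LogBounds
import HarnessLib

/-!
# Vinogradov's shift along a line `Im z = b` for the lattice sums `∑ λ^m(z) N(z)^{-it}` over `ℤ[i]`

Topic `Literature/NumberTheory/LFunctions`.  Everything in this file is PROVED; no definitions, no named facts.
This is the first step of the in-tree proof of the `ℚ(i)`-analogue of Vinogradov's estimate for the zeta sums —
M. D. Coleman's Theorem 1 (Mathematika 37 (1990)) for `K = ℚ(i)`, conductor `1` — by Korobov's method run ON THE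
LINES `Im z = b` of the lattice: for `z = a + bi ∈ ℤ[i]`, `b ≠ 0`, the summand
`Φ(z) = λ^m(z) N(z)^{-it} = (z/|z|)^{4m} |z|^{-2it}` (`λ^m = GaussianInt.angularChar m`) satisfies, for a natural
number (indeed any integer) `h` with `h/|z| < 1`,

  `Φ(z + h) = Φ(z) · e(Im(w · log(1 + h/z))/2π)`,   `w = 4m − 2ti`            (`phase_add_intCast`),

(`(1+v)/|1+v| = e^{i arg(1+v)}`, `|1+v|^{-2it} = e^{-2it Re log(1+v)}`), and the Taylor expansion of `log(1+v)`
(Mathlib's `Complex.norm_log_sub_logTaylor_le`) turns `Im(w log(1 + xy/z))/2π` into the polynomial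
`∑_{j ≤ r} α_j(z) (xy)^j`, `α_j(z) = (−1)^{j-1} Im(w z^{-j})/(2πj)` — the exact analogue of Ivić's
`α_j(n) = (−1)^j t/(2πj n^j)` for `n^{-it}` (`VinogradovZetaSumShift.lean`), up to the factor
`Im(w z^{-j})/|w z^{-j}| ∈ [−1, 1]`.  Main results:

* `norm_lineSum_le_shift` — **the shift** (Ivić (6.36)–(6.40) on a line): for `b ≠ 0`, `−|b| ≤ A₁ ≤ A₂ ≤ |b|`,
  `a₀ ≥ 1` with `2a₀² ≤ |b|`, and any `r`,
  `‖∑_{A₁ ≤ a ≤ A₂} Φ(a + bi)‖ ≤ a₀⁻² ∑_a |∑_{x,y ≤ a₀} e(∑_{j<r} α_{j+1}(a + bi) x^{j+1}y^{j+1})| + 6|b|·|w|·(a₀²/|b|)^{r+1} + 2a₀²`;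
* `im_sq_or_im_div_sq` — **non-degeneracy of consecutive coefficients**: for `|Re z| ≤ |Im z|`, `z ≠ 0`, and any
  `u`, `(Im u)² ≥ (9/100)|u|²` or `(Im(u/z))² ≥ (9/100)|u/z|²` (applied to `u = w z^{-j}`, `u/z = w z^{-j-1}`: of two
  consecutive Taylor coefficients at least one has the full size `≥ (3/10)|w| |z|^{-j}/(2πj)`).

## References

* A. Ivić, *The Riemann Zeta-Function*, Wiley 1985, §6.3, proof of Theorem 6.2, (6.36)–(6.40).
  [cite: Ivic1985, Theorem 6.2 (proof)]
* M. D. Coleman, *A zero-free region for the Hecke L-functions*, Mathematika 37 (1990), 287–304, Theorem 1.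
  [cite: ColemanMathematika1990, Theorem 1]
-/

noncomputable section

open Complex Finset Real

namespace Literature.NumberTheory.LFunctions

namespace GaussLine

open VdC (e)
open GaussianInt (angularChar angularChar_def norm_angularChar)

/-! ### Elementary facts -/

/-- `e(Im ξ /2π) = exp(i Im ξ)`. [folklore] -/
theorem e_im_div_two_pi (ξ : ℂ) : e (ξ.im / (2 * π)) = Complex.exp (ξ.im * I) := by
  unfold VdC.e
  congr 1
  have hπ : (π : ℝ) ≠ 0 := Real.pi_ne_zero
  push_cast
  field_simp

/-- A Gaussian integer with nonzero imaginary part is nonzero in `ℂ`. [folklore] -/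
theorem coe_ne_zero_of_im {z : GaussianInt} (hz : z.im ≠ 0) : (z : ℂ) ≠ 0 := by
  intro h
  rw [GaussianInt.toComplex_eq_zero] at h
  exact hz (by rw [h]; rfl)

/-- `N(z) = ‖z‖²` as real numbers. [folklore] -/
theorem norm_cast_eq_sq (z : GaussianInt) : (z.norm : ℝ) = ‖(z : ℂ)‖ ^ 2 := by
  rw [GaussianInt.intCast_real_norm, Complex.sq_norm]

/-- `|Φ(z)| = 1`: `‖λ^m(z) N(z)^{-it}‖ = 1` for `z ≠ 0`. [folklore] -/
theorem norm_phase_eq_one (m : ℕ) (t : ℝ) {z : GaussianInt} (hz : z ≠ 0) :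
    ‖angularChar m z * (((z.norm : ℝ)) : ℂ) ^ (-(t * I))‖ = 1 := by
  have hN : (0 : ℝ) < (z.norm : ℝ) := by exact_mod_cast GaussianInt.norm_pos.mpr hz
  rw [norm_mul, norm_angularChar hz, one_mul, Complex.norm_cpow_eq_rpow_re_of_pos hN]
  simp

/-! ### The factorisation `Φ(z + h) = Φ(z) e(Im(w log(1 + h/z))/2π)` -/

/-- For `ζ ≠ 0`: `(ζ/|ζ|)^{4m} = exp(4m · arg ζ · i)`. [folklore] -/
theorem div_norm_pow_eq_exp {ζ : ℂ} (hζ : ζ ≠ 0) (m : ℕ) :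
    (ζ / (‖ζ‖ : ℂ)) ^ (4 * m) = Complex.exp ((4 * m : ℕ) * (arg ζ * I)) := by
  rw [Complex.exp_nat_mul]
  congr 1
  have hn : (‖ζ‖ : ℂ) ≠ 0 := by exact_mod_cast (norm_ne_zero_iff.mpr hζ)
  rw [div_eq_iff hn, mul_comm]
  exact (Complex.norm_mul_exp_arg_mul_I _).symm

/-- For a positive real `x`: `x^{-it} = exp(−it log x)` with the real logarithm. [folklore] -/
theorem ofReal_cpow_neg_tI {x : ℝ} (hx : 0 < x) (t : ℝ) :
    ((x : ℝ) : ℂ) ^ (-(t * I)) = Complex.exp (-(t * I) * Real.log x) := by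
  rw [Complex.cpow_def_of_ne_zero (by exact_mod_cast hx.ne'), ← Complex.ofReal_log hx.le]
  ring_nf

/-- **The factorisation.**  For `z ∈ ℤ[i]`, `z ≠ 0`, an integer `h` and `v = h/z` with `‖v‖ < 1`:
`λ^m(z + h) N(z + h)^{-it} = λ^m(z) N(z)^{-it} · e(Im(w log(1 + v))/2π)`, `w = 4m − 2ti`. [folklore] -/
theorem phase_add_intCast (m : ℕ) (t : ℝ) {z : GaussianInt} (hz : z ≠ 0) (h : ℤ)
    (hv : ‖((h : ℂ) / (z : ℂ))‖ < 1) :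
    angularChar m (z + h) * ((((z + h).norm : ℝ)) : ℂ) ^ (-(t * I)) =
      angularChar m z * (((z.norm : ℝ)) : ℂ) ^ (-(t * I)) *
        e ((((4 * m : ℂ) - 2 * t * I) * Complex.log (1 + (h : ℂ) / (z : ℂ))).im / (2 * π)) := by
  set v : ℂ := (h : ℂ) / (z : ℂ) with hvdef
  have hz' : (z : ℂ) ≠ 0 := by rwa [Ne, GaussianInt.toComplex_eq_zero]
  have h1v : 1 + v ≠ 0 := by
    intro h0
    have : ‖v‖ = 1 := by
      have : v = -1 := by linear_combination h0
      rw [this, norm_neg, norm_one]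
    linarith
  have hzh : ((z + h : GaussianInt) : ℂ) = (z : ℂ) * (1 + v) := by
    rw [hvdef, map_add, map_intCast]; field_simp
  have hzh0 : ((z + h : GaussianInt) : ℂ) ≠ 0 := by rw [hzh]; exact mul_ne_zero hz' h1v
  have hzh0' : (z + h : GaussianInt) ≠ 0 := by
    intro h0; rw [h0] at hzh0; simp at hzh0
  -- the angular part
  have hang : angularChar m (z + h) = angularChar m z * Complex.exp ((4 * m : ℕ) * ((Complex.log (1 + v)).im * I)) := by
    rw [angularChar_def, angularChar_def, hzh, norm_mul, Complex.ofReal_mul, mul_div_mul_comm, mul_pow,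
      div_norm_pow_eq_exp h1v, ← Complex.log_im]
  -- the norm part
  have hN : (((z + h).norm : ℝ)) = (z.norm : ℝ) * ‖1 + v‖ ^ 2 := by
    rw [norm_cast_eq_sq, norm_cast_eq_sq, hzh, norm_mul, mul_pow]
  have hNz : (0 : ℝ) < (z.norm : ℝ) := by exact_mod_cast GaussianInt.norm_pos.mpr hz
  have h1v' : 0 < ‖1 + v‖ := norm_pos_iff.mpr h1v
  have hnorm : ((((z + h).norm : ℝ)) : ℂ) ^ (-(t * I)) =
      (((z.norm : ℝ)) : ℂ) ^ (-(t * I)) * Complex.exp (-(t * I) * (2 * (Complex.log (1 + v)).re)) := by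
    rw [hN, Complex.ofReal_mul, Complex.mul_cpow_ofReal_nonneg hNz.le (by positivity)]
    congr 1
    rw [ofReal_cpow_neg_tI (by positivity) t, Real.log_pow, ← Complex.log_re]
    push_cast; ring_nf
  rw [hang, hnorm, e_im_div_two_pi]
  -- compare the exponentials
  have hexp : Complex.exp ((4 * m : ℕ) * ((Complex.log (1 + v)).im * I)) *
      Complex.exp (-(t * I) * (2 * (Complex.log (1 + v)).re)) =
      Complex.exp ((((4 * m : ℂ) - 2 * t * I) * Complex.log (1 + v)).im * I) := by
    rw [← Complex.exp_add]
    congr 1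
    rw [Complex.mul_im]
    simp only [sub_re, sub_im, mul_re, mul_im, re_ofNat, im_ofNat, natCast_re, natCast_im, ofReal_re,
      ofReal_im, I_re, I_im]
    push_cast
    ring
  rw [← hexp]
  ring

/-! ### Taylor expansion of the phase -/

/-- The imaginary part of the Taylor polynomial: with `v = ξ/z`, `ξ` real,
`Im(w · logTaylor_{r+1}(v))/2π = ∑_{j<r} α_j · ξ^{j+1}`, `α_j = (−1)^j Im(w z^{-(j+1)})/(2π(j+1))`. [folklore] -/
theorem im_mul_logTaylor (w z : ℂ) (ξ : ℝ) (r : ℕ) :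
    (w * Complex.logTaylor (r + 1) ((ξ : ℂ) / z)).im / (2 * π) =
      ∑ j : Fin r, ((-1) ^ (j.val) * (w * (z⁻¹) ^ (j.val + 1)).im / (2 * π * (j.val + 1))) * ξ ^ (j.val + 1) := by
  simp only [Complex.logTaylor]
  rw [Finset.sum_range_succ', Nat.cast_zero, div_zero, add_zero, Finset.mul_sum, Complex.im_sum,
    Finset.sum_div, ← Fin.sum_univ_eq_sum_range]
  refine Finset.sum_congr rfl fun j _ ↦ ?_
  have hξ : ((ξ : ℂ) / z) ^ (j.val + 1) = ((ξ ^ (j.val + 1) : ℝ) : ℂ) * (z⁻¹) ^ (j.val + 1) := by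
    rw [div_eq_mul_inv, mul_pow]; push_cast; ring
  rw [hξ]
  have hcoef : w * ((-1) ^ (j.val + 1 + 1) * (((ξ ^ (j.val + 1) : ℝ) : ℂ) * (z⁻¹) ^ (j.val + 1)) / ((j.val + 1 : ℕ) : ℂ)) =
      ((((-1 : ℝ) ^ j.val * ξ ^ (j.val + 1) / (j.val + 1) : ℝ)) : ℂ) * (w * (z⁻¹) ^ (j.val + 1)) := by
    have hj : ((j.val + 1 : ℕ) : ℂ) ≠ 0 := Nat.cast_ne_zero.mpr (by omega)
    push_cast
    field_simp
    ring
  rw [hcoef, Complex.im_ofReal_mul]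
  have hπ : (π : ℝ) ≠ 0 := Real.pi_ne_zero
  field_simp

/-- **Taylor step**: for `‖v‖ ≤ 1/2`, `v = ξ/z`:
`|e(Im(w log(1+v))/2π) − e(∑_{j<r} α_j ξ^{j+1})| ≤ 2 |w| ‖v‖^{r+1}`. [folklore] -/
theorem norm_e_phase_sub_e_taylor_le (w : ℂ) {z : ℂ} (ξ : ℝ) (r : ℕ) (hv : ‖(ξ : ℂ) / z‖ ≤ 1 / 2) :
    ‖e ((w * Complex.log (1 + (ξ : ℂ) / z)).im / (2 * π)) -
        e (∑ j : Fin r, ((-1) ^ (j.val) * (w * (z⁻¹) ^ (j.val + 1)).im / (2 * π * (j.val + 1))) * ξ ^ (j.val + 1))‖ ≤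
      2 * ‖w‖ * ‖(ξ : ℂ) / z‖ ^ (r + 1) := by
  -- `|e(A) − e(B)| ≤ 2π|A − B|` (as in `FordVK.norm_e_sub_e_le`, not imported here)
  have norm_e_sub_e_le : ∀ A B : ℝ, ‖e A - e B‖ ≤ 2 * π * |A - B| := by
    intro A B
    have h1 : e A - e B = e B * (e (A - B) - 1) := by
      rw [mul_sub, mul_one, ← VdC.e_add]; congr 1; ring_nf
    rw [h1, norm_mul, VdC.norm_e, one_mul]
    have h2 : e (A - B) = Complex.exp (Complex.I * ((2 * π * (A - B) : ℝ) : ℂ)) := by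
      unfold VdC.e; rw [mul_comm]
    rw [h2]
    refine (Real.norm_exp_I_mul_ofReal_sub_one_le).trans (le_of_eq ?_)
    rw [Real.norm_eq_abs, abs_mul, abs_mul, abs_two, abs_of_pos Real.pi_pos]
  set v : ℂ := (ξ : ℂ) / z with hvdef
  have hv1 : ‖v‖ < 1 := by linarith
  rw [← im_mul_logTaylor w z ξ r]
  refine (norm_e_sub_e_le _ _).trans ?_
  rw [← sub_div, ← Complex.sub_im, ← mul_sub, abs_div, abs_of_pos (by positivity : (0 : ℝ) < 2 * π)]
  have hT := Complex.norm_log_sub_logTaylor_le r hv1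
  have him : |(w * (Complex.log (1 + v) - Complex.logTaylor (r + 1) v)).im| ≤
      ‖w‖ * (‖v‖ ^ (r + 1) * (1 - ‖v‖)⁻¹ / (r + 1)) := by
    refine (Complex.abs_im_le_norm _).trans ?_
    rw [norm_mul]
    exact mul_le_mul_of_nonneg_left hT (norm_nonneg _)
  have h2 : ‖v‖ ^ (r + 1) * (1 - ‖v‖)⁻¹ / (r + 1) ≤ 2 * ‖v‖ ^ (r + 1) := by
    have hr : (1 : ℝ) ≤ (r : ℝ) + 1 := by linarith [(Nat.cast_nonneg r : (0 : ℝ) ≤ r)]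
    have hinv : (1 - ‖v‖)⁻¹ ≤ 2 := by
      rw [inv_le_comm₀ (by linarith) (by norm_num)]; linarith
    have hv0 : 0 ≤ ‖v‖ ^ (r + 1) := by positivity
    calc ‖v‖ ^ (r + 1) * (1 - ‖v‖)⁻¹ / (r + 1) ≤ ‖v‖ ^ (r + 1) * (1 - ‖v‖)⁻¹ / 1 :=
          div_le_div_of_nonneg_left (by positivity) one_pos hr
      _ ≤ ‖v‖ ^ (r + 1) * 2 / 1 := by gcongr
      _ = 2 * ‖v‖ ^ (r + 1) := by ring
  calc 2 * π * (|(w * (Complex.log (1 + v) - Complex.logTaylor (r + 1) v)).im| / (2 * π))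
      = |(w * (Complex.log (1 + v) - Complex.logTaylor (r + 1) v)).im| := by field_simp
    _ ≤ ‖w‖ * (2 * ‖v‖ ^ (r + 1)) := him.trans (mul_le_mul_of_nonneg_left h2 (norm_nonneg _))
    _ = 2 * ‖w‖ * ‖v‖ ^ (r + 1) := by ring

/-! ### Non-degeneracy of consecutive coefficients -/

/-- Real form: if `q² ≤ (9/100)(p² + q²)` and `a² ≤ b²` then `(9/100)(p² + q²)(a² + b²) ≤ (aq − bp)²`. [folklore] -/
theorem sq_ineq_of_small_im {p q a b : ℝ} (hq : q ^ 2 ≤ 9 / 100 * (p ^ 2 + q ^ 2)) (hab : a ^ 2 ≤ b ^ 2) :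
    9 / 100 * (p ^ 2 + q ^ 2) * (a ^ 2 + b ^ 2) ≤ (a * q - b * p) ^ 2 := by
  -- `|q| ≤ |p|/3`, `|a| ≤ |b|`
  have hq9 : q ^ 2 ≤ p ^ 2 / 9 := by nlinarith
  have hq3 : 3 * |q| ≤ |p| := by
    have h : (3 * q) ^ 2 ≤ p ^ 2 := by nlinarith
    have := sq_le_sq.mp h
    rwa [abs_mul, show |(3 : ℝ)| = 3 by norm_num] at this
  have hab' : |a| ≤ |b| := sq_le_sq.mp hab
  -- `|aq − bp| ≥ |b||p| − |a||q| ≥ (2/3)|b||p|`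
  have hkey : 2 / 3 * (|b| * |p|) ≤ |a * q - b * p| := by
    have h1 : |b * p| - |a * q| ≤ |a * q - b * p| := by
      rw [abs_sub_comm (a * q)]; exact abs_sub_abs_le_abs_sub _ _
    rw [abs_mul, abs_mul] at h1
    have h2 : |a| * |q| ≤ |b| * (|p| / 3) := by
      have : |q| ≤ |p| / 3 := by linarith
      exact mul_le_mul hab' this (abs_nonneg _) (abs_nonneg _)
    nlinarith [abs_nonneg b, abs_nonneg p]
  have hsq : (2 / 3 * (|b| * |p|)) ^ 2 ≤ (a * q - b * p) ^ 2 := by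
    rw [← sq_abs (a * q - b * p)]
    exact pow_le_pow_left₀ (by positivity) hkey 2
  rw [mul_pow, mul_pow, sq_abs, sq_abs] at hsq
  nlinarith [mul_le_mul_of_nonneg_left hab (sq_nonneg p), mul_le_mul_of_nonneg_left hab (sq_nonneg q),
    mul_le_mul_of_nonneg_left hq9 (sq_nonneg b), hsq, sq_nonneg p, sq_nonneg b]

/-- **Non-degeneracy of consecutive coefficients.**  Let `z ≠ 0` with `|Re z| ≤ |Im z|` and `u ∈ ℂ`.  Then
`(Im u)² ≥ (9/100)‖u‖²` or `(Im(u/z))² ≥ (9/100)‖u/z‖²`: with `u = w z^{-j}` (so `u/z = w z^{-j-1}`), of two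
consecutive Taylor coefficients `α_j ∝ Im(w z^{-j})` at least one has modulus `≥ (3/10)|w||z|^{-j}` (up to `2πj`).
Proof: `Im(u z̄) = (Re z) Im u − (Im z) Re u` and `sq_ineq_of_small_im`. [folklore] -/
theorem im_sq_or_im_div_sq {z : ℂ} (hz : z ≠ 0) (hre : |z.re| ≤ |z.im|) (u : ℂ) :
    9 / 100 * ‖u‖ ^ 2 ≤ u.im ^ 2 ∨ 9 / 100 * ‖u / z‖ ^ 2 ≤ (u / z).im ^ 2 := by
  by_cases h : 9 / 100 * ‖u‖ ^ 2 ≤ u.im ^ 2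
  · exact Or.inl h
  · right
    rw [not_le] at h
    have hu2 : ‖u‖ ^ 2 = u.re ^ 2 + u.im ^ 2 := by rw [Complex.sq_norm, Complex.normSq_apply]; ring
    have hz2 : ‖z‖ ^ 2 = z.re ^ 2 + z.im ^ 2 := by rw [Complex.sq_norm, Complex.normSq_apply]; ring
    have hnz : Complex.normSq z = z.re ^ 2 + z.im ^ 2 := by rw [Complex.normSq_apply]; ring
    have hnz0 : 0 < z.re ^ 2 + z.im ^ 2 := by
      rw [← hnz]; exact Complex.normSq_pos.mpr hz
    have hab : z.re ^ 2 ≤ z.im ^ 2 := by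
      rw [← sq_abs z.re, ← sq_abs z.im]; exact pow_le_pow_left₀ (abs_nonneg _) hre 2
    have hq : u.im ^ 2 ≤ 9 / 100 * (u.re ^ 2 + u.im ^ 2) := by rw [← hu2]; exact h.le
    have key := sq_ineq_of_small_im hq hab
    -- `Im(u/z) = (Im u Re z − Re u Im z)/|z|²`, `‖u/z‖² = ‖u‖²/‖z‖²`
    have him : (u / z).im = (z.re * u.im - z.im * u.re) / (z.re ^ 2 + z.im ^ 2) := by
      rw [Complex.div_im, hnz]; ring
    have hnorm : ‖u / z‖ ^ 2 = (u.re ^ 2 + u.im ^ 2) / (z.re ^ 2 + z.im ^ 2) := by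
      rw [norm_div, div_pow, hu2, hz2]
    rw [him, hnorm, div_pow, ← mul_div_assoc, div_le_div_iff₀ hnz0 (by positivity)]
    calc 9 / 100 * (u.re ^ 2 + u.im ^ 2) * (z.re ^ 2 + z.im ^ 2) ^ 2
        = (9 / 100 * (u.re ^ 2 + u.im ^ 2) * (z.re ^ 2 + z.im ^ 2)) * (z.re ^ 2 + z.im ^ 2) := by ring
      _ ≤ (z.re * u.im - z.im * u.re) ^ 2 * (z.re ^ 2 + z.im ^ 2) :=
          mul_le_mul_of_nonneg_right key hnz0.le

/-! ### The shift on an integer interval -/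

/-- **The shift**: for `|g| ≤ 1` and `d ≥ 0`, `|∑_{A₁ ≤ a ≤ A₂} g(a) − ∑_{A₁ ≤ a ≤ A₂} g(a + d)| ≤ 2d`.
[cite: Ivic1985, Theorem 6.2 (proof)] -/
theorem norm_sum_Icc_sub_sum_Icc_shift_le {g : ℤ → ℂ} (hg : ∀ a, ‖g a‖ ≤ 1) (A₁ A₂ : ℤ) {d : ℤ} (hd : 0 ≤ d) :
    ‖∑ a ∈ Icc A₁ A₂, g a - ∑ a ∈ Icc A₁ A₂, g (a + d)‖ ≤ 2 * d := by
  classical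
  have hshift : ∑ a ∈ Icc A₁ A₂, g (a + d) = ∑ a ∈ Icc (A₁ + d) (A₂ + d), g a := by
    rw [← Finset.image_add_right_Icc, sum_image (fun x _ y _ h => by simpa using h)]
  rw [hshift, ← Finset.sum_sdiff_sub_sum_sdiff]
  have hb : ∀ s : Finset ℤ, ‖∑ a ∈ s, g a‖ ≤ s.card := fun s =>
    (norm_sum_le _ _).trans (by
      calc ∑ a ∈ s, ‖g a‖ ≤ ∑ _a ∈ s, (1 : ℝ) := sum_le_sum fun a _ => hg a
        _ = s.card := by simp)
  have h1 : (Icc A₁ A₂ \ Icc (A₁ + d) (A₂ + d)) ⊆ Icc A₁ (A₁ + d - 1) := by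
    intro a ha
    simp only [mem_sdiff, mem_Icc, not_and, not_le] at ha ⊢
    refine ⟨ha.1.1, ?_⟩
    by_contra hcon
    push Not at hcon
    have := ha.2 (by omega)
    omega
  have h2 : (Icc (A₁ + d) (A₂ + d) \ Icc A₁ A₂) ⊆ Icc (A₂ + 1) (A₂ + d) := by
    intro a ha
    simp only [mem_sdiff, mem_Icc, not_and, not_le] at ha ⊢
    refine ⟨?_, ha.1.2⟩
    by_contra hcon
    push Not at hcon
    have := ha.2 (by omega)
    omega
  have hc1 : ((Icc A₁ A₂ \ Icc (A₁ + d) (A₂ + d)).card : ℝ) ≤ d := by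
    have := card_le_card h1
    rw [Int.card_Icc] at this
    have h' : (A₁ + d - 1 + 1 - A₁).toNat = d.toNat := by congr 1; ring
    rw [h'] at this
    calc ((Icc A₁ A₂ \ Icc (A₁ + d) (A₂ + d)).card : ℝ) ≤ (d.toNat : ℝ) := by exact_mod_cast this
      _ = d := by exact_mod_cast Int.toNat_of_nonneg hd
  have hc2 : ((Icc (A₁ + d) (A₂ + d) \ Icc A₁ A₂).card : ℝ) ≤ d := by
    have := card_le_card h2
    rw [Int.card_Icc] at this
    have h' : (A₂ + d + 1 - (A₂ + 1)).toNat = d.toNat := by congr 1; ring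
    rw [h'] at this
    calc ((Icc (A₁ + d) (A₂ + d) \ Icc A₁ A₂).card : ℝ) ≤ (d.toNat : ℝ) := by exact_mod_cast this
      _ = d := by exact_mod_cast Int.toNat_of_nonneg hd
  calc ‖∑ a ∈ Icc A₁ A₂ \ Icc (A₁ + d) (A₂ + d), g a - ∑ a ∈ Icc (A₁ + d) (A₂ + d) \ Icc A₁ A₂, g a‖
      ≤ ‖∑ a ∈ Icc A₁ A₂ \ Icc (A₁ + d) (A₂ + d), g a‖ + ‖∑ a ∈ Icc (A₁ + d) (A₂ + d) \ Icc A₁ A₂, g a‖ :=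
        norm_sub_le _ _
    _ ≤ d + d := add_le_add ((hb _).trans hc1) ((hb _).trans hc2)
    _ = 2 * d := by ring

/-- `⟨a, b⟩ + h = ⟨a + h, b⟩` in `ℤ[i]` for an integer `h`. [folklore] -/
theorem mk_add_intCast (a b h : ℤ) : (⟨a, b⟩ : GaussianInt) + (h : GaussianInt) = ⟨a + h, b⟩ := by
  ext <;> simp

/-- `‖⟨a, b⟩‖ ≥ |b|` in `ℂ`. [folklore] -/
theorem abs_le_norm_mk (a b : ℤ) : (|b| : ℝ) ≤ ‖((⟨a, b⟩ : GaussianInt) : ℂ)‖ := by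
  have := Complex.abs_im_le_norm (((⟨a, b⟩ : GaussianInt) : ℂ))
  rw [GaussianInt.toComplex_def'] at this ⊢
  simpa using this

set_option maxHeartbeats 1600000 in
/-- **Vinogradov's shift on the line `Im z = b`** (Ivić (6.36)–(6.40) for the lattice sums).  Let `b ≠ 0`,
`−|b| ≤ A₁`, `A₂ ≤ |b|`, `a₀ ≥ 1` with `2a₀² ≤ |b|`, `r ∈ ℕ`, `w = 4m − 2ti`, and for `a ∈ ℤ` put `z_a = a + bi`,
`Φ(z_a) = λ^m(z_a) N(z_a)^{-it}`, `α_j(a) = (−1)^j Im(w z_a^{-(j+1)})/(2π(j+1))` (`j < r`).  Then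
`‖∑_{A₁ ≤ a ≤ A₂} Φ(z_a)‖ ≤ a₀⁻² ∑_{A₁ ≤ a ≤ A₂} |∑_{x,y ≤ a₀} e(∑_{j<r} α_j(a) x^{j+1}y^{j+1})|
  + 6|b| · |w| · (a₀²/|b|)^{r+1} + 2a₀²`.
[cite: Ivic1985, Theorem 6.2 (proof), (6.36)–(6.40)] [cite: ColemanMathematika1990, Theorem 1] -/
theorem norm_lineSum_le_shift {b : ℤ} (hb : b ≠ 0) {A₁ A₂ : ℤ} (hA₁ : -|b| ≤ A₁) (hA₂ : A₂ ≤ |b|) (m : ℕ) (t : ℝ)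
    {a₀ : ℕ} (ha₀ : 1 ≤ a₀) (haN : 2 * (a₀ : ℝ) ^ 2 ≤ |(b : ℝ)|) (r : ℕ) :
    ‖∑ a ∈ Icc A₁ A₂, angularChar m ⟨a, b⟩ * (((((⟨a, b⟩ : GaussianInt).norm : ℝ)) : ℂ) ^ (-(t * I)))‖ ≤
      1 / (a₀ : ℝ) ^ 2 * ∑ a ∈ Icc A₁ A₂,
          ‖∑ x ∈ Icc (1 : ℤ) a₀, ∑ y ∈ Icc (1 : ℤ) a₀,
            e (∑ j : Fin r, ((-1) ^ (j.val) * (((4 * (m : ℂ) - 2 * t * I)) *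
              (((⟨a, b⟩ : GaussianInt) : ℂ)⁻¹) ^ (j.val + 1)).im / (2 * π * (j.val + 1))) *
                ((x : ℝ) ^ (j.val + 1) * (y : ℝ) ^ (j.val + 1)))‖ +
        6 * |(b : ℝ)| * ‖(4 * (m : ℂ) - 2 * t * I)‖ * ((a₀ : ℝ) ^ 2 / |(b : ℝ)|) ^ (r + 1) + 2 * (a₀ : ℝ) ^ 2 := by
  classical
  -- notation
  set w : ℂ := 4 * (m : ℂ) - 2 * t * I with hw
  set B : ℝ := |(b : ℝ)| with hB
  have hB0 : 0 < B := by rw [hB]; exact abs_pos.mpr (by exact_mod_cast hb)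
  set zOf : ℤ → GaussianInt := fun a ↦ ⟨a, b⟩ with hzOf
  have hz0 : ∀ a, zOf a ≠ 0 := fun a h0 ↦ hb (by have := congrArg Zsqrtd.im h0; simpa [hzOf] using this)
  have hzC0 : ∀ a, (zOf a : ℂ) ≠ 0 := fun a ↦ by rw [Ne, GaussianInt.toComplex_eq_zero]; exact hz0 a
  have hzB : ∀ a, B ≤ ‖(zOf a : ℂ)‖ := fun a ↦ by
    rw [hB]; exact abs_le_norm_mk a b
  set f : ℤ → ℂ := fun a ↦ angularChar m (zOf a) * ((((zOf a).norm : ℝ)) : ℂ) ^ (-(t * I)) with hf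
  set S := ∑ a ∈ Icc A₁ A₂, f a with hS
  set A : Finset ℤ := Icc (1 : ℤ) a₀ with hA
  have ha0 : (0 : ℝ) < a₀ := by exact_mod_cast ha₀
  have hAcard : (A.card : ℝ) = a₀ := by rw [hA, Int.card_Icc]; simp
  have hAcardN : A.card = a₀ := by rw [hA, Int.card_Icc]; simp
  have hf1 : ∀ a, ‖f a‖ ≤ 1 := fun a ↦ (norm_phase_eq_one m t (hz0 a)).le
  -- the coefficients and the double sums
  let α : ℤ → Fin r → ℝ := fun a j ↦ (-1) ^ (j.val) * (w * ((zOf a : ℂ)⁻¹) ^ (j.val + 1)).im / (2 * π * (j.val + 1))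
  let T : ℤ → ℂ := fun a ↦ ∑ x ∈ A, ∑ y ∈ A, e (∑ j : Fin r, α a j * ((x : ℝ) ^ (j.val + 1) * (y : ℝ) ^ (j.val + 1)))
  -- cardinality of the `a`-range
  have hcardI : ((Icc A₁ A₂).card : ℝ) ≤ 3 * B := by
    rw [Int.card_Icc]
    have hbB : (|b| : ℝ) = B := by rw [hB]
    have h1B : 1 ≤ B := by
      rw [← hbB]; exact_mod_cast Int.one_le_abs hb
    rcases le_or_gt (A₂ + 1 - A₁) 0 with h | h
    · rw [Int.toNat_of_nonpos h]; simp; linarith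
    · have : ((A₂ + 1 - A₁).toNat : ℝ) = ((A₂ + 1 - A₁ : ℤ) : ℝ) := by exact_mod_cast Int.toNat_of_nonneg h.le
      rw [this]; push_cast
      have h1 : (A₂ : ℝ) ≤ |(b : ℝ)| := by rw [← Int.cast_abs]; exact_mod_cast hA₂
      have h2 : -|(b : ℝ)| ≤ (A₁ : ℝ) := by rw [← Int.cast_abs]; exact_mod_cast hA₁
      rw [← hB] at h1 h2
      linarith
  -- Step 1: the shift, for each pair `(x, y)`
  have hxy : ∀ x ∈ A, ∀ y ∈ A, (0 : ℤ) ≤ x * y ∧ ((x * y : ℤ) : ℝ) ≤ (a₀ : ℝ) ^ 2 ∧ (0 : ℝ) ≤ ((x * y : ℤ) : ℝ) := by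
    intro x hx y hy
    rw [hA, mem_Icc] at hx hy
    have hx0 : (0 : ℝ) ≤ x := by exact_mod_cast (by omega : (0 : ℤ) ≤ x)
    have hy0 : (0 : ℝ) ≤ y := by exact_mod_cast (by omega : (0 : ℤ) ≤ y)
    have hxa : (x : ℝ) ≤ a₀ := by exact_mod_cast hx.2
    have hya : (y : ℝ) ≤ a₀ := by exact_mod_cast hy.2
    refine ⟨mul_nonneg (by omega) (by omega), ?_, ?_⟩
    · push_cast; nlinarith
    · push_cast; positivity
  have hpair : ∀ x ∈ A, ∀ y ∈ A, ‖S - ∑ a ∈ Icc A₁ A₂, f (a + x * y)‖ ≤ 2 * (a₀ : ℝ) ^ 2 := by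
    intro x hx y hy
    obtain ⟨h0, hle, -⟩ := hxy x hx y hy
    refine (norm_sum_Icc_sub_sum_Icc_shift_le hf1 A₁ A₂ h0).trans ?_
    linarith
  -- Step 2: factorisation and Taylor at each `(a, x, y)`
  have hterm : ∀ a ∈ Icc A₁ A₂, ∀ x ∈ A, ∀ y ∈ A,
      ‖f (a + x * y) - f a * e (∑ j : Fin r, α a j * ((x : ℝ) ^ (j.val + 1) * (y : ℝ) ^ (j.val + 1)))‖ ≤
        2 * ‖w‖ * ((a₀ : ℝ) ^ 2 / B) ^ (r + 1) := by
    intro a _ x hx y hy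
    obtain ⟨h0, hle, hnn⟩ := hxy x hx y hy
    set z : GaussianInt := zOf a with hzdef
    set ξ : ℝ := ((x * y : ℤ) : ℝ) with hξ
    -- `‖v‖ ≤ a₀²/B ≤ 1/2`
    have hv_eq : ‖(((x * y : ℤ)) : ℂ) / (z : ℂ)‖ = ξ / ‖(z : ℂ)‖ := by
      rw [norm_div]
      congr 1
      rw [show (((x * y : ℤ)) : ℂ) = ((ξ : ℝ) : ℂ) by rw [hξ]; push_cast; ring, Complex.norm_real,
        Real.norm_of_nonneg hnn]
    have hvle : ‖(((x * y : ℤ)) : ℂ) / (z : ℂ)‖ ≤ (a₀ : ℝ) ^ 2 / B := by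
      rw [hv_eq]
      calc ξ / ‖(z : ℂ)‖ ≤ (a₀ : ℝ) ^ 2 / ‖(z : ℂ)‖ := by gcongr
        _ ≤ (a₀ : ℝ) ^ 2 / B := by
            apply div_le_div_of_nonneg_left (by positivity) hB0 (hzB a)
    have ha2B : (a₀ : ℝ) ^ 2 / B ≤ 1 / 2 := by
      rw [div_le_iff₀ hB0]; linarith
    have hvhalf : ‖(((x * y : ℤ)) : ℂ) / (z : ℂ)‖ ≤ 1 / 2 := hvle.trans ha2B
    have hv1 : ‖(((x * y : ℤ)) : ℂ) / (z : ℂ)‖ < 1 := by linarith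
    -- factorisation
    have hfac : f (a + x * y) = f a * e (((w * Complex.log (1 + (((x * y : ℤ)) : ℂ) / (z : ℂ))).im) / (2 * π)) := by
      have hza : zOf (a + x * y) = z + ((x * y : ℤ) : GaussianInt) := by
        rw [hzdef, hzOf]; dsimp only; rw [mk_add_intCast]
      rw [hf]; dsimp only
      rw [hza, phase_add_intCast m t (hz0 a) (x * y) hv1]
    rw [hfac, ← mul_sub, norm_mul]
    refine (mul_le_of_le_one_left (norm_nonneg _) (hf1 a)).trans ?_
    -- Taylor
    have hpoly : ∑ j : Fin r, α a j * ((x : ℝ) ^ (j.val + 1) * (y : ℝ) ^ (j.val + 1)) =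
        ∑ j : Fin r, ((-1) ^ (j.val) * (w * ((z : ℂ)⁻¹) ^ (j.val + 1)).im / (2 * π * (j.val + 1))) * ξ ^ (j.val + 1) := by
      refine sum_congr rfl fun j _ ↦ ?_
      rw [hξ]; push_cast; rw [mul_pow]
    have hξC : (((x * y : ℤ)) : ℂ) = ((ξ : ℝ) : ℂ) := by rw [hξ]; push_cast; ring
    rw [hpoly, hξC]
    rw [hξC] at hvhalf hvle
    refine (norm_e_phase_sub_e_taylor_le w ξ r hvhalf).trans ?_
    have hv0 : 0 ≤ ‖((ξ : ℝ) : ℂ) / (z : ℂ)‖ := norm_nonneg _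
    gcongr
  -- Step 3: summing over `a`
  have hsum_xy : ‖∑ x ∈ A, ∑ y ∈ A, ∑ a ∈ Icc A₁ A₂, f (a + x * y)‖ ≤
      ∑ a ∈ Icc A₁ A₂, ‖T a‖ + 3 * B * (a₀ : ℝ) ^ 2 * (2 * ‖w‖ * ((a₀ : ℝ) ^ 2 / B) ^ (r + 1)) := by
    have hswap : ∑ x ∈ A, ∑ y ∈ A, ∑ a ∈ Icc A₁ A₂, f (a + x * y) =
        ∑ a ∈ Icc A₁ A₂, ∑ x ∈ A, ∑ y ∈ A, f (a + x * y) := by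
      calc ∑ x ∈ A, ∑ y ∈ A, ∑ a ∈ Icc A₁ A₂, f (a + x * y)
          = ∑ x ∈ A, ∑ a ∈ Icc A₁ A₂, ∑ y ∈ A, f (a + x * y) := sum_congr rfl fun x _ => sum_comm
        _ = ∑ a ∈ Icc A₁ A₂, ∑ x ∈ A, ∑ y ∈ A, f (a + x * y) := sum_comm
    rw [hswap]
    refine (norm_sum_le _ _).trans ?_
    have hn_each : ∀ a ∈ Icc A₁ A₂, ‖∑ x ∈ A, ∑ y ∈ A, f (a + x * y)‖ ≤
        ‖T a‖ + (a₀ : ℝ) ^ 2 * (2 * ‖w‖ * ((a₀ : ℝ) ^ 2 / B) ^ (r + 1)) := by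
      intro a ha
      have hdiff : ‖∑ x ∈ A, ∑ y ∈ A, f (a + x * y) - f a * T a‖ ≤
          (a₀ : ℝ) ^ 2 * (2 * ‖w‖ * ((a₀ : ℝ) ^ 2 / B) ^ (r + 1)) := by
        simp only [T]
        rw [mul_sum, ← sum_sub_distrib]
        refine (norm_sum_le _ _).trans ?_
        calc ∑ x ∈ A, ‖∑ y ∈ A, f (a + x * y) - f a *
              ∑ y ∈ A, e (∑ j : Fin r, α a j * ((x : ℝ) ^ (j.val + 1) * (y : ℝ) ^ (j.val + 1)))‖
            ≤ ∑ x ∈ A, ∑ y ∈ A, (2 * ‖w‖ * ((a₀ : ℝ) ^ 2 / B) ^ (r + 1)) := by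
              refine sum_le_sum fun x hx => ?_
              rw [mul_sum, ← sum_sub_distrib]
              refine (norm_sum_le _ _).trans (sum_le_sum fun y hy => hterm a ha x hx y hy)
          _ = (a₀ : ℝ) ^ 2 * (2 * ‖w‖ * ((a₀ : ℝ) ^ 2 / B) ^ (r + 1)) := by
              rw [sum_const, sum_const, nsmul_eq_mul, nsmul_eq_mul, hAcard]; ring
      have hmain : ‖f a * T a‖ ≤ ‖T a‖ := by
        rw [norm_mul]; exact mul_le_of_le_one_left (norm_nonneg _) (hf1 a)
      calc ‖∑ x ∈ A, ∑ y ∈ A, f (a + x * y)‖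
          ≤ ‖f a * T a‖ + ‖∑ x ∈ A, ∑ y ∈ A, f (a + x * y) - f a * T a‖ := norm_le_norm_add_norm_sub' _ _
        _ ≤ ‖T a‖ + (a₀ : ℝ) ^ 2 * (2 * ‖w‖ * ((a₀ : ℝ) ^ 2 / B) ^ (r + 1)) := add_le_add hmain hdiff
    have hE0 : 0 ≤ (a₀ : ℝ) ^ 2 * (2 * ‖w‖ * ((a₀ : ℝ) ^ 2 / B) ^ (r + 1)) := by positivity
    calc ∑ a ∈ Icc A₁ A₂, ‖∑ x ∈ A, ∑ y ∈ A, f (a + x * y)‖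
        ≤ ∑ a ∈ Icc A₁ A₂, (‖T a‖ + (a₀ : ℝ) ^ 2 * (2 * ‖w‖ * ((a₀ : ℝ) ^ 2 / B) ^ (r + 1))) := sum_le_sum hn_each
      _ = ∑ a ∈ Icc A₁ A₂, ‖T a‖ + (Icc A₁ A₂).card * ((a₀ : ℝ) ^ 2 * (2 * ‖w‖ * ((a₀ : ℝ) ^ 2 / B) ^ (r + 1))) := by
          rw [sum_add_distrib, sum_const, nsmul_eq_mul]
      _ ≤ ∑ a ∈ Icc A₁ A₂, ‖T a‖ + (3 * B) * ((a₀ : ℝ) ^ 2 * (2 * ‖w‖ * ((a₀ : ℝ) ^ 2 / B) ^ (r + 1))) := by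
          gcongr
      _ = _ := by ring
  -- Step 4: averaging
  have hS_avg : (a₀ : ℂ) ^ 2 * S = ∑ x ∈ A, ∑ y ∈ A, S := by
    rw [sum_const, sum_const, smul_smul, nsmul_eq_mul, hAcardN]
    push_cast; ring
  have hdiff : ‖(a₀ : ℂ) ^ 2 * S - ∑ x ∈ A, ∑ y ∈ A, ∑ a ∈ Icc A₁ A₂, f (a + x * y)‖ ≤ 2 * (a₀ : ℝ) ^ 4 := by
    rw [hS_avg, ← sum_sub_distrib]
    refine (norm_sum_le _ _).trans ?_
    calc ∑ x ∈ A, ‖∑ y ∈ A, S - ∑ y ∈ A, ∑ a ∈ Icc A₁ A₂, f (a + x * y)‖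
        ≤ ∑ x ∈ A, ∑ y ∈ A, 2 * (a₀ : ℝ) ^ 2 := by
          refine sum_le_sum fun x hx => ?_
          rw [← sum_sub_distrib]
          exact (norm_sum_le _ _).trans (sum_le_sum fun y hy => hpair x hx y hy)
      _ = 2 * (a₀ : ℝ) ^ 4 := by rw [sum_const, sum_const, nsmul_eq_mul, nsmul_eq_mul, hAcard]; ring
  have hkey : (a₀ : ℝ) ^ 2 * ‖S‖ ≤ ∑ a ∈ Icc A₁ A₂, ‖T a‖ +
      3 * B * (a₀ : ℝ) ^ 2 * (2 * ‖w‖ * ((a₀ : ℝ) ^ 2 / B) ^ (r + 1)) + 2 * (a₀ : ℝ) ^ 4 := by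
    have h1 : (a₀ : ℝ) ^ 2 * ‖S‖ = ‖(a₀ : ℂ) ^ 2 * S‖ := by
      rw [norm_mul, norm_pow, Complex.norm_natCast]
    rw [h1]
    calc ‖(a₀ : ℂ) ^ 2 * S‖ ≤ ‖∑ x ∈ A, ∑ y ∈ A, ∑ a ∈ Icc A₁ A₂, f (a + x * y)‖ +
          ‖(a₀ : ℂ) ^ 2 * S - ∑ x ∈ A, ∑ y ∈ A, ∑ a ∈ Icc A₁ A₂, f (a + x * y)‖ :=
          norm_le_norm_add_norm_sub' _ _
      _ ≤ _ := by linarith [hsum_xy, hdiff]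
  have ha2 : (0 : ℝ) < (a₀ : ℝ) ^ 2 := by positivity
  have hfinal : ‖S‖ ≤ 1 / (a₀ : ℝ) ^ 2 * ∑ a ∈ Icc A₁ A₂, ‖T a‖ +
      6 * B * ‖w‖ * ((a₀ : ℝ) ^ 2 / B) ^ (r + 1) + 2 * (a₀ : ℝ) ^ 2 := by
    rw [show ‖S‖ = 1 / (a₀ : ℝ) ^ 2 * ((a₀ : ℝ) ^ 2 * ‖S‖) by field_simp]
    calc 1 / (a₀ : ℝ) ^ 2 * ((a₀ : ℝ) ^ 2 * ‖S‖)
        ≤ 1 / (a₀ : ℝ) ^ 2 * (∑ a ∈ Icc A₁ A₂, ‖T a‖ +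
            3 * B * (a₀ : ℝ) ^ 2 * (2 * ‖w‖ * ((a₀ : ℝ) ^ 2 / B) ^ (r + 1)) + 2 * (a₀ : ℝ) ^ 4) := by gcongr
      _ = 1 / (a₀ : ℝ) ^ 2 * ∑ a ∈ Icc A₁ A₂, ‖T a‖ + 6 * B * ‖w‖ * ((a₀ : ℝ) ^ 2 / B) ^ (r + 1) +
            2 * (a₀ : ℝ) ^ 2 := by
          field_simp
          ring
  exact hfinal

end GaussLine

end Literature.NumberTheory.LFunctions
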